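import Literature.NumberTheory.Transcendental.FormsAlgebraWedgeProofs
import Mathlib.LinearAlgebra.Matrix.Determinant.Basic
import Mathlib.LinearAlgebra.ExteriorPower.Basis
import HarnessLib

/-!
# Iterated wedge products of `1`-forms are determinants

For continuous alternating maps on a normed space `V` with values in a normed commutative
`𝕜`-algebra `A` (the pointwise model of the tree's differential forms, wedge product
`ContinuousAlternatingMap.wedge` of `FormsAlgebra`, Warner's normalisation), this file proves the
classical formula
`(θ₀ ∧ θ₁ ∧ ⋯ ∧ θ_{k-1})(v₀, …, v_{k-1}) = det (θᵢ(vⱼ))`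
for `1`-forms `θᵢ` (Warner (1983), 2.10–2.13; Bott–Tu (1982), §I.1), where the iterated wedge
`iterWedge k θ = θ₀ ∧ (θ₁ ∧ (⋯ ∧ 1))` is bracketed to the right and degree-cast to `Fin k` at each
step — exactly the pointwise shape of `Literature.AlgebraicGeometry.HodgeTheory.dWedge`
(`dg₀ ∧ ⋯ ∧ dg_{k-1}` of the realisation of algebraic form expressions).

* `one_wedge_domDomCongr_apply` — first-slot (Laplace) expansion of `θ ∧ β` for a `1`-form `θ`:
  `(θ ∧ β)(v₀, …, v_l) = ∑ₚ (-1)ᵖ θ(vₚ) β(v with vₚ removed)`;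
* `iterWedge_apply` — the determinant formula;
* `iterWedgeAlt` — the iterated wedge as an `A`-multilinear ALTERNATING map in the `1`-forms
  (multilinearity and alternation of `det` in its rows);
* `linearIndependent_iterWedge_of_dual` — if `θ₀, …, θ_{m-1}` admit dual vectors
  (`θ_a(w_b) = δ_{ab}`), the iterated wedges `θ_J`, `J` running over the increasing `n`-tuples,
  are `A`-linearly independent (evaluate on the dual tuples: `θ_J(w_{J'}) = δ_{JJ'}`, the
  computation of Mathlib's `exteriorPower.ιMultiDual_apply_diag/nondiag`).

These are the multilinear-algebra inputs of the injectivity "algebraic forms with vanishing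
realisation vanish" used to discharge `conj_realize_mem_cclosedSmoothForms`.

## References

* F. W. Warner, *Foundations of Differentiable Manifolds and Lie Groups*, GTM 94 (1983), 2.10–2.13.
* R. Bott, L. W. Tu, *Differential Forms in Algebraic Topology* (1982), §I.1.
-/

noncomputable section

open Set

namespace ContinuousAlternatingMap

section IterWedge

variable {𝕜 : Type*} [RCLike 𝕜] {V : Type*} [NormedAddCommGroup V] [NormedSpace 𝕜 V]
  {A : Type*} [NormedCommRing A] [NormedAlgebra 𝕜 A] {k l : ℕ}

/-- The **iterated wedge** `θ₀ ∧ (θ₁ ∧ (⋯ ∧ 1))` of a `k`-tuple of `1`-forms, a `k`-form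
(bracketed to the right, degree-cast from `1 + j` to `j + 1` at each step, as in
`Literature.AlgebraicGeometry.HodgeTheory.dWedge`). Deliberate extension of the Mathlib namespace
`ContinuousAlternatingMap` (like `wedge`). [cite: Warner1983, 2.10] -/
def iterWedge : (k : ℕ) → (Fin k → V [⋀^Fin 1]→L[𝕜] A) → V [⋀^Fin k]→L[𝕜] A
  | 0, _ => constOfIsEmpty 𝕜 V (Fin 0) (1 : A)
  | k + 1, θ => ((θ 0).wedge (iterWedge k (Fin.tail θ))).domDomCongr (finCongr (Nat.add_comm 1 k))

/-- The empty iterated wedge is the constant `1`. [folklore] -/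
@[simp]
theorem iterWedge_zero (θ : Fin 0 → V [⋀^Fin 1]→L[𝕜] A) :
    iterWedge 0 θ = constOfIsEmpty 𝕜 V (Fin 0) (1 : A) := rfl

/-- The recursion `θ₀ ∧ ⋯ ∧ θ_k = θ₀ ∧ (θ₁ ∧ ⋯ ∧ θ_k)`, cast to degree `k + 1`. [folklore] -/
theorem iterWedge_succ (θ : Fin (k + 1) → V [⋀^Fin 1]→L[𝕜] A) :
    iterWedge (k + 1) θ =
      ((θ 0).wedge (iterWedge k (Fin.tail θ))).domDomCongr (finCongr (Nat.add_comm 1 k)) := rfl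

/-- **First-slot expansion** of the wedge with a `1`-form on the left (Warner (1983), 2.10(b)
with `k = 1`; the Laplace expansion along the first row): after the degree cast `1 + l = l + 1`,
`(θ ∧ β)(v₀, …, v_l) = ∑ₚ (-1)ᵖ θ(vₚ) · β(v₀, …, v̂ₚ, …, v_l)`. [cite: Warner1983, 2.10] -/
theorem one_wedge_domDomCongr_apply (θ : V [⋀^Fin 1]→L[𝕜] A) (β : V [⋀^Fin l]→L[𝕜] A)
    (v : Fin (l + 1) → V) :
    (θ.wedge β).domDomCongr (finCongr (Nat.add_comm 1 l)) v =
      ∑ p : Fin (l + 1), ((-1 : ℤ) ^ (p : ℕ)) • (θ ![v p] * β (p.removeNth v)) := by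
  classical
  set e : Fin (l + 1) ≃ Fin (1 + l) := finCongr (Nat.add_comm l 1) with he
  set g : (Fin (l + 1) → V) → A := fun w ↦ θ ![w 0] * β (fun j ↦ w j.succ) with hg
  set w : Fin (1 + l) → V := fun i ↦ v (finCongr (Nat.add_comm 1 l) i) with hw
  have hwe : w ∘ e = v := by
    funext i
    rfl
  -- each summand of the shuffle formula is `g` of a permuted tuple
  have h1 : ∀ σ : Equiv.Perm (Fin (1 + l)),
      θ (fun i ↦ w (σ (Fin.castAdd l i))) * β (fun j ↦ w (σ (Fin.natAdd 1 j))) =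
        g (w ∘ σ ∘ e) := by
    intro σ
    simp only [hg, Function.comp_apply]
    congr 1
    · congr 1
      funext i
      have hi : i = 0 := Subsingleton.elim i 0
      subst hi
      simp only [Matrix.cons_val_zero]
      congr 2
    · congr 1
      funext j
      congr 2
      ext
      simp only [he, Fin.val_natAdd, finCongr_apply, Fin.val_cast, Fin.val_succ, Nat.add_comm]
  have h2 : ∑ σ : Equiv.Perm (Fin (1 + l)), (Equiv.Perm.sign σ : ℤ) • g (w ∘ σ ∘ e) =
      ∑ τ : Equiv.Perm (Fin (l + 1)), (Equiv.Perm.sign τ : ℤ) • g (v ∘ τ) := by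
    rw [← Literature.NumberTheory.Transcendental.sum_perm_sign_smul_comp_equiv e g w]
    simp only [← Function.comp_assoc, hwe]
  -- the inner alternating sum over the remaining slots is `l!` copies of `β`
  have h3 : ∀ p : Fin (l + 1),
      ∑ τ : Equiv.Perm (Fin l), (Equiv.Perm.sign τ : ℤ) • g (Fin.cons (v p) (p.removeNth v ∘ τ)) =
        (l.factorial : ℤ) • (θ ![v p] * β (p.removeNth v)) := by
    intro p
    have hterm : ∀ τ : Equiv.Perm (Fin l),
        (Equiv.Perm.sign τ : ℤ) • g (Fin.cons (v p) (p.removeNth v ∘ τ)) =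
          θ ![v p] * β (p.removeNth v) := by
      intro τ
      have hβ : β (p.removeNth v ∘ τ) = Equiv.Perm.sign τ • β (p.removeNth v) := by
        rw [← coe_toAlternatingMap, AlternatingMap.map_perm]
      simp only [hg, Fin.cons_zero, Fin.cons_succ]
      change (Equiv.Perm.sign τ : ℤ) • (θ ![v p] * β (p.removeNth v ∘ τ)) = _
      rw [hβ, Units.smul_def, mul_smul_comm, smul_smul, ← Units.val_mul, Int.units_mul_self,
        Units.val_one, one_smul]
    rw [Finset.sum_congr rfl fun τ _ ↦ hterm τ, Finset.sum_const, Finset.card_univ,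
      Fintype.card_perm, Fintype.card_fin, ← natCast_zsmul]
  rw [domDomCongr_apply, Literature.NumberTheory.Transcendental.wedge_apply_zsmul]
  change ((Nat.factorial 1 * l.factorial : ℕ) : 𝕜)⁻¹ •
      ∑ σ : Equiv.Perm (Fin (1 + l)), (Equiv.Perm.sign σ : ℤ) •
        (θ (fun i ↦ w (σ (Fin.castAdd l i))) * β (fun j ↦ w (σ (Fin.natAdd 1 j)))) = _
  simp_rw [h1]
  rw [h2, Literature.NumberTheory.Transcendental.sum_perm_sign_smul_comp_eq_sum_cons g v]
  simp_rw [h3]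
  rw [Finset.smul_sum]
  refine Finset.sum_congr rfl fun p _ ↦ ?_
  rw [Nat.factorial_one, one_mul, smul_comm ((-1 : ℤ) ^ (p : ℕ)) (l.factorial : ℤ),
    ← Int.cast_smul_eq_zsmul 𝕜 (l.factorial : ℤ), Int.cast_natCast, smul_smul,
    inv_mul_cancel₀ (Nat.cast_ne_zero.2 (Nat.factorial_ne_zero l)), one_smul]

/-- **Iterated wedges of `1`-forms are determinants**:
`(θ₀ ∧ ⋯ ∧ θ_{k-1})(v₀, …, v_{k-1}) = det (θᵢ(vⱼ))ᵢⱼ` (Warner (1983), 2.13 footnote / Bott–Tu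
§I.1; induction on `k` by the first-slot expansion and the Laplace expansion of `det` along the
first row, `Matrix.det_succ_row_zero`). [cite: Warner1983, 2.10] -/
theorem iterWedge_apply (θ : Fin k → V [⋀^Fin 1]→L[𝕜] A) (v : Fin k → V) :
    iterWedge k θ v = (Matrix.of fun i j ↦ θ i ![v j]).det := by
  induction k with
  | zero => simp [Matrix.det_isEmpty]
  | succ k ih =>
    rw [iterWedge_succ, one_wedge_domDomCongr_apply, Matrix.det_succ_row_zero]
    refine Finset.sum_congr rfl fun p _ ↦ ?_
    rw [ih, zsmul_eq_mul, Int.cast_pow, Int.cast_neg, Int.cast_one, mul_assoc]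
    congr 2

/-- Updating one `1`-form updates one row of the matrix `(θᵢ(vⱼ))`. [folklore] -/
theorem of_update_eq_updateRow [DecidableEq (Fin k)] (θ : Fin k → V [⋀^Fin 1]→L[𝕜] A)
    (i : Fin k) (x : V [⋀^Fin 1]→L[𝕜] A) (v : Fin k → V) :
    (Matrix.of fun a b ↦ (Function.update θ i x) a ![v b]) =
      Matrix.updateRow (Matrix.of fun a b ↦ θ a ![v b]) i (fun b ↦ x ![v b]) := by
  ext a b
  simp only [Matrix.of_apply, Matrix.updateRow_apply, Function.update_apply]
  split_ifs <;> rfl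

variable (𝕜 V A k) in
/-- **The iterated wedge as an alternating map** in its `1`-form arguments: `θ ↦ θ₀ ∧ ⋯ ∧ θ_{k-1}`
is `A`-multilinear and alternating (because `det` is, in its rows). [cite: Warner1983, 2.6] -/
def iterWedgeAlt : (V [⋀^Fin 1]→L[𝕜] A) [⋀^Fin k]→ₗ[A] (V [⋀^Fin k]→L[𝕜] A) where
  toFun θ := iterWedge k θ
  map_update_add' := @fun inst θ i x y ↦ by
    obtain rfl : inst = instDecidableEqFin k := Subsingleton.elim _ _
    ext v
    simp only [add_apply, iterWedge_apply, of_update_eq_updateRow]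
    rw [show (fun b ↦ x ![v b] + y ![v b]) = (fun b ↦ x ![v b]) + fun b ↦ y ![v b] from rfl,
      Matrix.det_updateRow_add]
  map_update_smul' := @fun inst θ i c x ↦ by
    obtain rfl : inst = instDecidableEqFin k := Subsingleton.elim _ _
    ext v
    simp only [smul_apply, iterWedge_apply, of_update_eq_updateRow]
    rw [show (fun b ↦ c • x ![v b]) = c • fun b ↦ x ![v b] from rfl, Matrix.det_updateRow_smul,
      smul_eq_mul]
  map_eq_zero_of_eq' θ i j h hij := by
    ext v
    change iterWedge k θ v = (0 : V [⋀^Fin k]→L[𝕜] A) v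
    rw [iterWedge_apply, coe_zero, Pi.zero_apply]
    exact Matrix.det_zero_of_row_eq hij (funext fun b ↦ by simp [h])

/-- `iterWedgeAlt` is `iterWedge` (definitional). [folklore] -/
@[simp]
theorem iterWedgeAlt_apply (θ : Fin k → V [⋀^Fin 1]→L[𝕜] A) : iterWedgeAlt 𝕜 V A k θ = iterWedge k θ :=
  rfl

/-- Evaluation at a fixed tuple of vectors, as an `A`-linear functional on `k`-forms. [folklore] -/
def evalₗ (v : Fin k → V) : (V [⋀^Fin k]→L[𝕜] A) →ₗ[A] A where
  toFun ω := ω v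
  map_add' _ _ := rfl
  map_smul' _ _ := rfl

/-- `evalₗ v ω = ω v` (definitional). [folklore] -/
@[simp]
theorem evalₗ_apply (v : Fin k → V) (ω : V [⋀^Fin k]→L[𝕜] A) : evalₗ v ω = ω v := rfl

/-- **Iterated wedges of a dual family are linearly independent.** If the `1`-forms
`θ₀, …, θ_{m-1}` admit dual vectors `w₀, …, w_{m-1}` (`θ_a(w_b) = δ_{ab}`), then the `n`-fold
iterated wedges `θ_{J(0)} ∧ ⋯ ∧ θ_{J(n-1)}`, `J` the increasing enumeration of an `n`-element subset
of `Fin m`, are `A`-linearly independent: evaluated on the dual tuple `(w_{J'(j)})ⱼ` they give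
`det [J(i) = J'(j)] = δ_{JJ'}` (the computation of Mathlib's `exteriorPower.ιMultiDual_apply_diag`,
`…_nondiag` for the basis `Pi.basisFun`). [cite: Warner1983, 2.6] -/
theorem linearIndependent_iterWedge_of_dual {m : ℕ} (θ : Fin m → V [⋀^Fin 1]→L[𝕜] A)
    (w : Fin m → V) (h : ∀ a b, θ a ![w b] = if a = b then 1 else 0) (n : ℕ) :
    LinearIndependent A fun s : powersetCard (Fin m) n ↦
      iterWedge n (θ ∘ (powersetCard.ofFinEmbEquiv.symm s)) := by
  classical
  set b : Module.Basis (Fin m) A (Fin m → A) := Pi.basisFun A (Fin m) with hb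
  have key : ∀ s t : powersetCard (Fin m) n,
      evalₗ (w ∘ (powersetCard.ofFinEmbEquiv.symm t))
          (iterWedge n (θ ∘ (powersetCard.ofFinEmbEquiv.symm s))) =
        exteriorPower.ιMultiDual A n b t (exteriorPower.ιMulti_family A n b s) := by
    intro s t
    rw [evalₗ_apply, iterWedge_apply, exteriorPower.ιMulti_family,
      exteriorPower.ιMultiDual_apply_ιMulti]
    congr 1
    ext i j
    simp only [Matrix.of_apply, Function.comp_apply, h, hb, Module.Basis.coord_apply,
      Module.Basis.repr_self, Finsupp.single_apply]
  refine LinearIndependent.of_pairwise_dual_eq_zero_one _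
    (fun t ↦ evalₗ (w ∘ (powersetCard.ofFinEmbEquiv.symm t))) (fun t s hts ↦ ?_) (fun s ↦ ?_)
  · change evalₗ _ (iterWedge n _) = 0
    rw [key, exteriorPower.ιMultiDual_apply_nondiag A n b t s hts]
  · rw [key, exteriorPower.ιMultiDual_apply_diag]

end IterWedge

end ContinuousAlternatingMap

/-! ### Regrouping an alternating sum over all index maps into increasing index maps -/

namespace AlternatingMap

variable {R : Type*} [CommRing R] {W G : Type*} [AddCommGroup W] [Module R W]
  [AddCommGroup G] [Module R G] {n m : ℕ}

/-- **Regrouping lemma.** For an alternating `n`-linear map `f`, vectors `u₀, …, u_{m-1}` and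
coefficients `c_I` indexed by ALL maps `I : Fin n → Fin m`,
`∑_I c_I f(u_{I(0)}, …, u_{I(n-1)}) = ∑_s (∑_I c_I · det[I(i) = J_s(j)]) f(u_{J_s(0)}, …)`,
`s` running over the `n`-element subsets of `Fin m` with increasing enumeration `J_s`
(non-injective `I` contribute `0`, and `I = J_s ∘ π` contributes `sign π`). Proof: `f ∘ u`
factors through the `n`-th exterior power of the free module `R^m`, where the element
`∑_I c_I e_{I(0)} ∧ ⋯ ∧ e_{I(n-1)}` is expanded in Mathlib's basis `Module.Basis.exteriorPower`,
whose coordinates are the determinants `exteriorPower.ιMultiDual_apply_ιMulti`.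
Deliberate extension of the Mathlib namespace `AlternatingMap`. [folklore] -/
theorem sum_smul_comp_eq_sum_powersetCard (f : W [⋀^Fin n]→ₗ[R] G) (u : Fin m → W)
    (c : (Fin n → Fin m) → R) :
    ∑ I : Fin n → Fin m, c I • f (u ∘ I) =
      ∑ s : powersetCard (Fin m) n,
        (∑ I : Fin n → Fin m, c I *
          (Matrix.of fun i j ↦
            if I i = (powersetCard.ofFinEmbEquiv.symm s) j then (1 : R) else 0).det) •
          f (u ∘ (powersetCard.ofFinEmbEquiv.symm s)) := by
  classical
  set b : Module.Basis (Fin m) R (Fin m → R) := Pi.basisFun R (Fin m) with hb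
  set B : Module.Basis (powersetCard (Fin m) n) R (⋀[R]^n (Fin m → R)) := b.exteriorPower n
    with hB
  set L : (Fin m → R) →ₗ[R] W := b.constr R u with hL
  have hLb : ∀ a, L (b a) = u a := fun a ↦ by rw [hL, Module.Basis.constr_basis]
  set F : ⋀[R]^n (Fin m → R) →ₗ[R] G :=
    exteriorPower.alternatingMapLinearEquiv (f.compLinearMap L) with hF
  have hFI : ∀ I : Fin n → Fin m, F (exteriorPower.ιMulti R n (b ∘ I)) = f (u ∘ I) := by
    intro I
    rw [hF, exteriorPower.alternatingMapLinearEquiv_apply_ιMulti, AlternatingMap.compLinearMap_apply]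
    congr 1
    funext i
    exact hLb (I i)
  set ω : ⋀[R]^n (Fin m → R) := ∑ I : Fin n → Fin m, c I • exteriorPower.ιMulti R n (b ∘ I) with hω
  have hLHS : ∑ I : Fin n → Fin m, c I • f (u ∘ I) = F ω := by
    simp only [hω, map_sum, map_smul, hFI]
  have hrepr : ∀ s : powersetCard (Fin m) n, B.repr ω s =
      ∑ I : Fin n → Fin m, c I *
        (Matrix.of fun i j ↦
          if I i = (powersetCard.ofFinEmbEquiv.symm s) j then (1 : R) else 0).det := by
    intro s
    simp only [hω, map_sum, map_smul, Finsupp.coe_finsetSum, Finsupp.coe_smul, Finset.sum_apply,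
      Pi.smul_apply, smul_eq_mul]
    refine Finset.sum_congr rfl fun I _ ↦ ?_
    rw [hB, exteriorPower.basis_repr_apply, exteriorPower.ιMultiDual_apply_ιMulti]
    congr 2
    ext i j
    simp only [Matrix.of_apply, Function.comp_apply, hb, Module.Basis.coord_apply,
      Module.Basis.repr_self, Finsupp.single_apply]
  have hBs : ∀ s : powersetCard (Fin m) n,
      F (B s) = f (u ∘ (powersetCard.ofFinEmbEquiv.symm s)) := by
    intro s
    rw [hB, exteriorPower.basis_apply, exteriorPower.ιMulti_family, hFI]
  rw [hLHS, ← B.sum_repr ω, map_sum]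
  exact Finset.sum_congr rfl fun s _ ↦ by rw [map_smul, hrepr, hBs]

end AlternatingMap

end
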